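import Literature.NumberTheory.EllipticCurves.ModularCurve
import Literature.NumberTheory.EllipticCurves.GlobalMinimalModel
import Literature.NumberTheory.DiophantineGeometry.Conductor
import HarnessLib
import HarnessLib.Audit.Tags

/-!
# Candidates E-es-1⁺ / E-es-1 / E-es-2 of cell `bsd-f2-manin` (D-0131 (3) frontier: the Manin
# constant at additive primes) — the ∞-side CUSP CERTIFICATE for `p ∤ c` at an additive prime.
# `@[conjecture]` leaves (NOTHING asserted; this module contains only the three definitions; the
# proved edges are in the sibling `InfinityCuspManinEdges.lean`).

HONEST FRAMING. LENS = Euler systems / explicit reciprocity (planner `bsd-f2-manin-es`, HOME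
`run/shared/lean/pub/bsd-f2-manin/MEMO-es.md` §§1–3, Sketch.lean namespace `…Ideas.ManinES`,
farm rc 0). Lens verdict (memo §0): every explicit-reciprocity statement is scale-free in
`(ω_E, Ω_E)`; the literature CONSUMES «`p ∤ c`» exactly at additive `p` (C.-H. Kim, AJM
(arXiv:2203.12159) p. 6; Kriz–Li, FMS 2019, Thm. 5.1; Wuthrich 2014); the one `E`-intrinsic
integral structure at an additive prime is Honda's formal group (`Ê ≅ Ĝ_a` integrally), and feeding
it through the Néron mapping property predicts: **the images of the ∞-side cusps `a/d`
(`p^{v_p(N)} ∣ d`) on the identity component detect `p ∣ c`.** Informal statements: (ES-1⁺) at an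
additive `p`, `p · (c · {∞ → a/d}_f) ∈ Λ_E` for every ∞-side cusp and every datum; (ES-1) if
`p ∣ c` then already `c · {∞ → a/d}_f ∈ Λ_E`; (ES-2, the bookable LAW) for a lattice-optimal datum
(`Λ_E = c·Λ_f`), ONE ∞-side cusp with `{∞ → a/d}_f ∉ Λ_f` certifies `p ∤ c`. NOT in print
(refuter-2 placement pending; memo §6: the ERL literature assumes `p ∤ c`, no source states a
cusp certificate). Proposed mechanism (memo §2 dictionary (†), needs the integral model of
`X₀(N)` — Katz–Mazur 13.4.7 fibre structure, Néron mapping property on `𝒳₀(N)^{sm}`, the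
`q`-expansion principle — none of which the tree has as of 2026-08-27; typer note in
HOME/CANDIDATES.md). BC5 WITNESS / falsifier: memo §4 (run in seat against Cremona's tables; the
∃-clause of ES-2 is non-vacuous: 20a1); `c ≡ 1` in range so ES-2 cannot be violated by data
(refuter-1 T4); ES-1⁺ is the data-toothed statement. Beyond-print theorem candidates: ES-1⁺, ES-1
(YES, per memo); ES-2 follows from ES-1 (edge). Refuter verdicts: REF1 **SURVIVES** for all
three 2026-08-27T14:02Z (HOME/REFUTER-ref1.md §R1.12–§R1.14: ES-1⁺ theorem candidate, 137 ∞-side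
cusp images N ≤ 200 with orders ⊆ {1, p}, 0 violations, 64 genuine; ES-1 kernel prediction 4/4;
ES-2 ∃-clause inhabited 28/80 at p = 2, 13/57 at p = 3; crux probes CLEAN); REF2 pending at filing.

RENDERING: VERBATIM the planner's Sketch.lean (memo §3). «Additive at `p`» is spelled on the
globally minimal model as `p ∣ Δ_min ∧ p ∣ c₄` (`WeierstrassCurve.minimalDiscriminantInt`,
`WeierstrassCurve.integralModelInt`; Silverman AEC VII.5.1 (c)); the ∞-side cusps of `X₀(N)` are
the `a/d` with `d ∣ N`, `p^{v_p(N)} ∣ d`, `gcd(a, d) = 1`; `{∞ → r}_f = modularSymbol D.f r`;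
`Λ_E = D.L.lattice` (Néron lattice of the minimal model), `Λ_f = periodLattice D.f`. ES-1⁺/ES-1 are
«AnyDatum» statements (no lattice clause — their conclusions are lattice memberships, not bounds
on `c`, so refuter-1 trap T1 does not apply); ES-2 carries the lattice clause (T1) and
`IsGloballyMinimal` (T2) and the conductor level (T3).
-/

noncomputable section

open scoped MatrixGroups ModularForm

open CongruenceSubgroup WeierstrassCurve
  Literature.NumberTheory.EllipticCurves Literature.NumberTheory.EllipticCurves.ModularForms

namespace Summit.BirchSwinnertonDyer.Rank1Residual.ManinAdditive

/-- **Candidate E-es-1⁺ `InfinityCuspTorsionAtAdditive` (cell bsd-f2-manin; OPEN, NOT in print,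
nothing asserted):** for a globally minimal `W/ℚ`, a datum `D` at the conductor level and a prime
`p` of ADDITIVE reduction (`p ∣ Δ_min`, `p ∣ c₄`), every ∞-side cusp `a/d` (`d ∣ N`,
`p^{v_p(N)} ∣ d`, `gcd(a,d) = 1`) has `p · (D.c · {∞ → a/d}_{D.f}) ∈ Λ_W` (the image of the cusp
under `φ_D` is killed by `p` in `E(ℚ̄)/E⁰`-bookkeeping: Honda `Ê ≅ Ĝ_a` + `ℰ⁰_{𝔽_p} = 𝔾_a`).
The sharp, data-toothed statement of the lens (memo §3 ES-1⁺).
[cite: Manin1972, §1.2–1.5 (shape only: modular symbols {∞, a/d}; the law is NOT in print — cell bsd-f2-manin MEMO-es.md §3)] -/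
@[conjecture] def InfinityCuspTorsionAtAdditive : Prop :=
  ∀ (W : WeierstrassCurve ℚ) [W.IsElliptic] [W.IsGloballyMinimal] [NeZero (W.conductorNorm ℤ)]
    (D : ModularParametrizationData W (W.conductorNorm ℤ)) (p : ℕ) [Fact p.Prime],
    (p : ℤ) ∣ minimalDiscriminantInt W → (p : ℤ) ∣ (integralModelInt W).c₄ →
    ∀ (a : ℤ) (d : ℕ), d ∣ W.conductorNorm ℤ → p ^ padicValNat p (W.conductorNorm ℤ) ∣ d →
      a.natAbs.Coprime d →
      (p : ℂ) * ((D.maninConstant : ℂ) * modularSymbol D.f ((a : ℚ) / d)) ∈ D.L.lattice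

/-- **Candidate E-es-1 `InfinityCuspCollapseOfDvdManin` (cell bsd-f2-manin; OPEN, NOT in print,
nothing asserted):** same setting; if `p ∣ D.c` then every ∞-side cusp symbol already lies in the
Néron lattice: `D.c · {∞ → a/d}_{D.f} ∈ Λ_W` (the lens's main statement, memo §3 ES-1: `p ∣ c`
collapses the ∞-side cusps onto the identity component).
[cite: Manin1972, §1.2–1.5 (shape only; the law is NOT in print — cell bsd-f2-manin MEMO-es.md §3)] -/
@[conjecture] def InfinityCuspCollapseOfDvdManin : Prop :=
  ∀ (W : WeierstrassCurve ℚ) [W.IsElliptic] [W.IsGloballyMinimal] [NeZero (W.conductorNorm ℤ)]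
    (D : ModularParametrizationData W (W.conductorNorm ℤ)) (p : ℕ) [Fact p.Prime],
    (p : ℤ) ∣ minimalDiscriminantInt W → (p : ℤ) ∣ (integralModelInt W).c₄ →
    (p : ℤ) ∣ D.maninConstant →
    ∀ (a : ℤ) (d : ℕ), d ∣ W.conductorNorm ℤ → p ^ padicValNat p (W.conductorNorm ℤ) ∣ d →
      a.natAbs.Coprime d →
      (D.maninConstant : ℂ) * modularSymbol D.f ((a : ℚ) / d) ∈ D.L.lattice

/-- **Candidate E-es-2 `ManinUnitOfInfinityCuspWitness` (cell bsd-f2-manin; the bookable LAW,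
lattice-optimal shape; OPEN, NOT in print, nothing asserted):** for a globally minimal `W`, a
datum `D` at the conductor level with `D.c ≠ 0` (a tree fact, `maninConstant_ne_zero_holds`,
kept as a binder VERBATIM from the planner's sketch) satisfying the lattice clause
`Λ_W = c·Λ_f`, and an additive prime `p`: ONE ∞-side cusp `a/d` with `{∞ → a/d}_{D.f} ∉ Λ_f`
certifies `p ∤ D.c`. Follows from `InfinityCuspCollapseOfDvdManin` (edge in the sibling file).
[cite: Manin1972, §1.2–1.5 (shape only; the law is NOT in print — cell bsd-f2-manin MEMO-es.md §3)] -/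
@[conjecture] def ManinUnitOfInfinityCuspWitness : Prop :=
  ∀ (W : WeierstrassCurve ℚ) [W.IsElliptic] [W.IsGloballyMinimal] [NeZero (W.conductorNorm ℤ)]
    (D : ModularParametrizationData W (W.conductorNorm ℤ)) (p : ℕ) [Fact p.Prime],
    (p : ℤ) ∣ minimalDiscriminantInt W → (p : ℤ) ∣ (integralModelInt W).c₄ →
    D.maninConstant ≠ 0 →
    (∀ z ∈ D.L.lattice, ∃ w ∈ periodLattice D.f, z = D.c * w) →
    (∃ (a : ℤ) (d : ℕ), d ∣ W.conductorNorm ℤ ∧ p ^ padicValNat p (W.conductorNorm ℤ) ∣ d ∧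
      a.natAbs.Coprime d ∧ modularSymbol D.f ((a : ℚ) / d) ∉ periodLattice D.f) →
    ¬ (p : ℤ) ∣ D.maninConstant

end Summit.BirchSwinnertonDyer.Rank1Residual.ManinAdditive

end
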